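import Summits.BirchSwinnertonDyer.BirchSwinnertonDyer.Theorems.ManinLocalTwoThreePrimeShiftGlue
import HarnessLib

/-!
# The PRIME-GENERIC descent engine, II: `Γ₀(p²n) → Γ₀(pn)` for EVERY `p` — an additive `p`-shift-invariant
# `φ : Γ₀(p²n) → K` descends as soon as `φ(P_{2/p}) = φ(P_{1/p})`
# (route `ManinLocalTwoThree`, cell bsd-f2-manin; the LEAD's prime-generic shift-equaliser law T-p1-g11-2
# `ShiftEqualiser.PrimeShiftInvariantIsDiamond`; prover seat p3 gen 11)

With the subgroups `A⁺ ⊴ Γ₀(pn)`, `A₀ = {p ∣ b}`, `B = Γ₀(p²n)` and the gluing lemma `glueBA` of the sibling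
`…PrimeShiftGlue.lean`: `φ∘coshift` (`coshiftVal`, `coshift(γ) = diag(p,1)⁻¹ γ diag(p,1) = (a, b/p; pc, d)`) is additive on
`A₀` (`coshift_add`), agrees with `φ` on `A₀ ∩ B` by the `p`-shift invariance (`coshift_eq_restr`), and its conjugation
invariance under `T` on `A⁺` reduces (`conj_invariant_of_generator`; `A⁺/(A⁺ ∩ B) ↪ ℤ/p` is generated by
`Q₁ = (1−pn, pn; −pn, 1+pn)`, `exists_mul_Q1_zpow_mem_subB`) to the SINGLE instance `φ(P_{2/p}) = φ(P_{1/p})` for the parabolic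
generators `P_{1/p} = (1−pn, n; −p²n, 1+pn)` (`P1`) and `P_{2/p} = (1−2pn, 4n; −p²n, 1+2pn)` (`P2`) of `Γ₀(p²n)` at the cusps `1/p`,
`2/p` (at `p = 2` these are the seat's `P_{1/2}`, `P₁`; at `p = 3` its `P_{1/3}`, `P_{2/3}`); the Bézout decomposition
`Γ₀(pn) = B·A⁺` (`exists_subB_inv_mul_mem_subA`) feeds `glueBA`.
**`PrimeShift.descent`**: `IsAdd φ → IsShiftInvariant p φ → φ (P2 p n) = φ (P1 p n) → ∃ w : Γ₀(pn) → K, IsAdd w ∧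
IsShiftInvariant p w ∧ RestrictsFrom φ w` — natively in the typer's generic `ShiftEqualiser` vocabulary, any commutative ring `K`,
any `p ≥ 1`, any `n`.  What a caller must still supply is the vanishing `φ(P_{2/p}) = φ(P_{1/p})` (sibling `…PrimeShiftTower.lean`:
automatic for `p² ∣ n` in characteristic `p`; absorbed by the Fermat-quotient character at `n` prime to `p`).
HONEST FRAMING: group theory of `Γ₀(N)` only; nothing about BSD, Manin's conjecture, C2/C3 or the LEAD's law is asserted.
Reference: cell memo HOME/MEMO-es.md §37.8; HOME/p1/CENSUS-shift-equaliser-p1-g11.md [cite: DarmonDiamondTaylor1995, Lemma 4.28 (p. 135)].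
-/


set_option autoImplicit false
set_option linter.dupNamespace false

open scoped MatrixGroups

open CongruenceSubgroup Matrix.SpecialLinearGroup
open Summit.BirchSwinnertonDyer.Rank1Residual.ManinAdditive.NineShiftEqualiser (slOf g0Of g0Of_congr)
open Summit.BirchSwinnertonDyer.Rank1Residual.ManinAdditive.ShiftEqualiser (IsAdd IsShiftInvariant RestrictsFrom)
open Summit.BirchSwinnertonDyer.BirchSwinnertonDyer.Theorems.ManinLocalTwoThree.ThreeShiftDescent (g0Of_mul det_mul_entries
  Tpow Tpow_mul_Tpow Tpow_zero Tpow_inv g0Of_mul_Tpow Tpow_one_mul_mul_Tpow_neg_one addOn_map_one addOn_map_inv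
  conj_invariant_of_generator conj_zpow_invariant)

namespace Summit.BirchSwinnertonDyer.BirchSwinnertonDyer.Theorems.ManinLocalTwoThree

namespace PrimeShift

/-! ### §2. The two maps `φ∘coshift` on `A₀` and `φ` on `B`; compatibility; the generator `Q₁`; the decomposition `Γ₀(pn) = B·A⁺` -/

section Engine

variable {K : Type*} [CommRing K] {p n : ℕ}

/-- `p²n ∣ pc` from `pn ∣ c`. [folklore] -/
theorem dvd_p_mul {c : ℤ} (hc : ((p * n : ℕ) : ℤ) ∣ c) : ((p * (p * n) : ℕ) : ℤ) ∣ p * c := by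
  obtain ⟨k, hk⟩ := hc
  exact ⟨k, by rw [hk]; push_cast; ring⟩

/-- **The coshift value** `φ(diag(p,1)⁻¹ γ diag(p,1)) = φ(a, b/p; pc, d)` of `γ = (a b; c d) ∈ Γ₀(pn)` when `p ∣ b`
(junk `0` otherwise). [folklore] -/
noncomputable def coshiftVal (φ : Gamma0 (p * (p * n)) → K) (γ : Gamma0 (p * n)) : K :=
  if h : (p : ℤ) ∣ ((γ : SL(2, ℤ)) 0 1 : ℤ) then
    φ (g0Of ((γ : SL(2, ℤ)) 0 0) (((γ : SL(2, ℤ)) 0 1 : ℤ) / p) (p * (γ : SL(2, ℤ)) 1 0) ((γ : SL(2, ℤ)) 1 1)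
      (by
        have hq : ((γ : SL(2, ℤ)) 0 1 : ℤ) / p * p = (γ : SL(2, ℤ)) 0 1 := Int.ediv_mul_cancel h
        linear_combination gamma0_det_entries γ - ((γ : SL(2, ℤ)) 1 0 : ℤ) * hq)
      (dvd_p_mul ((ZMod.intCast_zmod_eq_zero_iff_dvd _ _).mp (Gamma0_mem.mp γ.2))))
  else 0

/-- `coshiftVal` on an explicit matrix `(a, pb; c, d)`: `φ(a, b; pc, d)` (`p ≠ 0`). [folklore] -/
theorem coshiftVal_g0Of [NeZero p] (φ : Gamma0 (p * (p * n)) → K) (a b c d : ℤ) (h : a * d - (p * b) * c = 1)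
    (hc : ((p * n : ℕ) : ℤ) ∣ c) (h' : a * d - b * (p * c) = 1) (hc' : ((p * (p * n) : ℕ) : ℤ) ∣ p * c) :
    coshiftVal φ (g0Of a (p * b) c d h hc) = φ (g0Of a b (p * c) d h' hc') := by
  unfold coshiftVal
  rw [dif_pos (show (p : ℤ) ∣ (((g0Of a (p * b) c d h hc : Gamma0 (p * n)) : SL(2, ℤ)) 0 1 : ℤ) from ⟨b, rfl⟩)]
  congr 1
  exact g0Of_congr rfl (by
    show (p * b) / p = b
    exact Int.mul_ediv_cancel_left b (by exact_mod_cast (NeZero.ne p))) rfl rfl _ _ _ _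

/-- **The restriction value** `φ(γ)` for `γ ∈ Γ₀(pn)` with `p²n ∣ c` (junk `0` otherwise). [folklore] -/
noncomputable def restrVal (φ : Gamma0 (p * (p * n)) → K) (γ : Gamma0 (p * n)) : K :=
  if h : ((p * (p * n) : ℕ) : ℤ) ∣ ((γ : SL(2, ℤ)) 1 0 : ℤ) then
    φ (g0Of ((γ : SL(2, ℤ)) 0 0) ((γ : SL(2, ℤ)) 0 1) ((γ : SL(2, ℤ)) 1 0) ((γ : SL(2, ℤ)) 1 1) (gamma0_det_entries γ) h)
  else 0

/-- `restrVal` on an explicit matrix with `p²n ∣ c`. [folklore] -/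
theorem restrVal_g0Of (φ : Gamma0 (p * (p * n)) → K) (a b c d : ℤ) (h : a * d - b * c = 1)
    (hc : ((p * n : ℕ) : ℤ) ∣ c) (hc' : ((p * (p * n) : ℕ) : ℤ) ∣ c) :
    restrVal φ (g0Of a b c d h hc) = φ (g0Of a b c d h hc') := by
  unfold restrVal
  rw [dif_pos (show ((p * (p * n) : ℕ) : ℤ) ∣ (((g0Of a b c d h hc : Gamma0 (p * n)) : SL(2, ℤ)) 1 0 : ℤ) from hc')]
  rfl

variable (φ : Gamma0 (p * (p * n)) → K)

/-- `φ∘coshift` is additive on `A₀ = {p ∣ b}` (the coshift is multiplicative there), for additive `φ`. [folklore] -/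
theorem coshift_add [NeZero p] (hadd : IsAdd φ) :
    ∀ x ∈ subA0 p n, ∀ y ∈ subA0 p n, coshiftVal φ (x * y) = coshiftVal φ x + coshiftVal φ y := by
  intro x hx y hy
  obtain ⟨a, b, c, d, h, hc, rfl⟩ := exists_eq_of_mem_subA0 hx
  obtain ⟨a', b', c', d', h', hc', rfl⟩ := exists_eq_of_mem_subA0 hy
  have hcp : ((p * n : ℕ) : ℤ) ∣ c * a' + d * c' := dvd_add (Dvd.dvd.mul_right hc _) (Dvd.dvd.mul_left hc' _)
  have hprod : (g0Of a (p * b) c d h hc * g0Of a' (p * b') c' d' h' hc' : Gamma0 (p * n)) =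
      g0Of (a * a' + (p * b) * c') (p * (a * b' + b * d')) (c * a' + d * c') (c * (p * b') + d * d')
        (by linear_combination (det_mul_entries h h')) hcp := by
    rw [g0Of_mul a (p * b) c d a' (p * b') c' d' h hc h' hc' (det_mul_entries h h') hcp]
    exact g0Of_congr rfl (by ring) rfl rfl _ _ _ _
  have hcp' : ((p * (p * n) : ℕ) : ℤ) ∣ p * c * a' + d * (p * c') := by
    have := dvd_p_mul hcp
    have e : (p : ℤ) * (c * a' + d * c') = p * c * a' + d * (p * c') := by ring
    rwa [e] at this
  rw [hprod, coshiftVal_g0Of φ _ _ _ _ _ _ (by linear_combination (det_mul_entries h h')) (dvd_p_mul hcp),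
    coshiftVal_g0Of φ a b c d h hc (by linear_combination h) (dvd_p_mul hc),
    coshiftVal_g0Of φ a' b' c' d' h' hc' (by linear_combination h') (dvd_p_mul hc'), ← hadd,
    g0Of_mul a b (p * c) d a' b' (p * c') d' _ _ _ _ (det_mul_entries (by linear_combination h)
      (by linear_combination h')) hcp']
  congr 1
  exact g0Of_congr (by ring) (by ring) (by ring) (by ring) _ _ _ _

/-- `φ` (as `restrVal`) is additive on `B`, for additive `φ`. [folklore] -/
theorem restr_add (hadd : IsAdd φ) :
    ∀ x ∈ subB p n, ∀ y ∈ subB p n, restrVal φ (x * y) = restrVal φ x + restrVal φ y := by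
  intro x hx y hy
  obtain ⟨a, b, c, d, h, hc, hcB, rfl⟩ := exists_eq_of_mem_subB hx
  obtain ⟨a', b', c', d', h', hc', hcB', rfl⟩ := exists_eq_of_mem_subB hy
  have hcB'' : ((p * (p * n) : ℕ) : ℤ) ∣ c * a' + d * c' := dvd_add (Dvd.dvd.mul_right hcB _) (Dvd.dvd.mul_left hcB' _)
  rw [g0Of_mul a b c d a' b' c' d' h hc h' hc' (det_mul_entries h h')
      (dvd_add (Dvd.dvd.mul_right hc _) (Dvd.dvd.mul_left hc' _)),
    restrVal_g0Of φ _ _ _ _ _ _ hcB'', restrVal_g0Of φ a b c d h hc hcB, restrVal_g0Of φ a' b' c' d' h' hc' hcB', ← hadd,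
    g0Of_mul]

/-- **Agreement on `A₀ ∩ B`**: `φ(coshift γ) = φ(γ)` for `γ = (a, pb; c, d)` with `p²n ∣ c` — this is the `p`-shift
invariance of `φ`. [folklore] -/
theorem coshift_eq_restr [NeZero p] (hinv : IsShiftInvariant (p : ℤ) φ) :
    ∀ x ∈ subA0 p n, x ∈ subB p n → coshiftVal φ x = restrVal φ x := by
  intro x hx hxB
  obtain ⟨a, b, c, d, h, hc, rfl⟩ := exists_eq_of_mem_subA0 hx
  have hcB : ((p * (p * n) : ℕ) : ℤ) ∣ c := (mem_subB p n).mp hxB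
  rw [coshiftVal_g0Of φ a b c d h hc (by linear_combination h) (dvd_p_mul hc),
    restrVal_g0Of φ a (p * b) c d h hc hcB, hinv a b c d (by linear_combination h) hcB]

/-- The exponent map `n(γ) := d·b`: `γ · T^{−db} ∈ A₀` (`b − adb = −b·bc`, `p ∣ c`). [folklore] -/
theorem mul_Tpow_neg_mem_subA0 (x : Gamma0 (p * n)) :
    x * (Tpow (p * n) 1) ^ (-(((x : SL(2, ℤ)) 1 1 : ℤ) * (x : SL(2, ℤ)) 0 1)) ∈ subA0 p n := by
  obtain ⟨a, b, c, d, h, hc, rfl⟩ := exists_eq_g0Of x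
  have hpc : (p : ℤ) ∣ c := p_dvd_c p n (g0Of a b c d h hc)
  rw [Tpow_one_zpow, g0Of_mul_Tpow a b c d h hc _ (by linear_combination h), mem_subA0]
  show (p : ℤ) ∣ a * -(d * b) + b
  have e : a * -(d * b) + b = -(b * b * c) - b * (a * d - b * c - 1) := by ring
  rw [e, h, sub_self, mul_zero, sub_zero]
  exact (Dvd.dvd.mul_left hpc _).neg_right

/-- The element `Q₁ = (1 − pn, pn; −pn, 1 + pn) ∈ A⁺` (the parabolic of `Γ₀(pn)` at the cusp `1`). [folklore] -/
def Q1 (p n : ℕ) : Gamma0 (p * n) :=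
  g0Of (1 - p * n) (p * n) (-(p * n)) (1 + p * n) (by ring) ⟨-1, by push_cast; ring⟩

/-- `Q₁ ∈ A⁺`. [folklore] -/
theorem Q1_mem_subA : Q1 p n ∈ subA p n :=
  (mem_subA p n).mpr ⟨⟨n, by simp [Q1, g0Of, slOf]⟩, ⟨-n, by simp [Q1, g0Of, slOf]⟩⟩

/-- Powers of `Q₁`: `Q₁^k = (1 − kpn, kpn; −kpn, 1 + kpn)`. [folklore] -/
theorem Q1_pow (k : ℕ) : (Q1 p n) ^ k =
    g0Of (1 - k * (p * n)) (k * (p * n)) (-(k * (p * n))) (1 + k * (p * n)) (by ring) ⟨-k, by push_cast; ring⟩ := by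
  induction k with
  | zero =>
      rw [pow_zero]
      apply Subtype.ext
      ext i j
      fin_cases i <;> fin_cases j <;> simp [g0Of, slOf]
  | succ k ih =>
      rw [pow_succ, ih, Q1, g0Of_mul _ _ _ _ _ _ _ _ _ _ _ _ (by ring) ⟨-(k + 1 : ℤ), by push_cast; ring⟩]
      exact g0Of_congr (by push_cast; ring) (by push_cast; ring) (by push_cast; ring) (by push_cast; ring) _ _ _ _

/-- **`Q₁` generates `A⁺` modulo `A⁺ ∩ B`** (`A⁺/(A⁺ ∩ B) ↪ ℤ/p` via `γ ↦ c_γ/(pn)`, a homomorphism because `a ≡ d ≡ 1`):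
for `γ ∈ A⁺` some `γ Q₁^{k}` lies in `B`. [folklore] -/
theorem exists_mul_Q1_zpow_mem_subB [NeZero p] (x : Gamma0 (p * n)) (hx : x ∈ subA p n) :
    ∃ e : ℤ, x * (Q1 p n) ^ (-e) ∈ subB p n := by
  obtain ⟨hb, ha⟩ := hx
  have hd : (p : ℤ) ∣ ((x : SL(2, ℤ)) 1 1 : ℤ) - 1 := dvd_d_sub_one p n hb ha
  obtain ⟨a, b, c, d, h, hc, rfl⟩ := exists_eq_g0Of x
  obtain ⟨c₀, hc₀⟩ := hc
  have hp0 : (p : ℤ) ≠ 0 := by exact_mod_cast (NeZero.ne p)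
  set k : ℕ := (c₀ % p).toNat with hk
  have hkz : (k : ℤ) = c₀ % p := by rw [hk, Int.toNat_of_nonneg (Int.emod_nonneg _ hp0)]
  refine ⟨-(k : ℤ), ?_⟩
  rw [neg_neg, zpow_natCast, Q1_pow, g0Of_mul a b c d _ _ _ _ _ _ _ _ (by linear_combination h)
    (dvd_add (Dvd.dvd.mul_right ⟨c₀, hc₀⟩ _) (Dvd.dvd.mul_left ⟨-(k : ℤ), by push_cast; ring⟩ _)), mem_subB]
  show ((p * (p * n) : ℕ) : ℤ) ∣ c * (1 - k * (p * n)) + d * -(k * (p * n))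
  -- `= pn·(c₀ − k(c + d))`, and `c₀ − k(c+d) = (c₀ − k) − k·c − k·(d − 1)` is divisible by `p`
  have hpc : (p : ℤ) ∣ c := ⟨n * c₀, by rw [hc₀]; push_cast; ring⟩
  have hck : (p : ℤ) ∣ c₀ - k := ⟨c₀ / p, by rw [hkz]; linear_combination (-1 : ℤ) * Int.emod_add_ediv_mul c₀ (p : ℤ)⟩
  obtain ⟨w, hw⟩ : (p : ℤ) ∣ (c₀ - k) - k * c - k * (d - 1) :=
    dvd_sub (dvd_sub hck (Dvd.dvd.mul_left hpc _)) (Dvd.dvd.mul_left hd _)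
  exact ⟨w, by
    have e : c * (1 - (k : ℤ) * (p * n)) + d * -(k * (p * n)) = (p * n : ℤ) * ((c₀ - k) - k * c - k * (d - 1)) := by
      rw [hc₀]; push_cast; ring
    rw [e, hw]; push_cast; ring⟩

/-- The parabolic `P_{1/p} = (1 − pn, n; −p²n, 1 + pn) ∈ Γ₀(p²n)` at the cusp `1/p` (`= diag(p,1)⁻¹ Q₁ diag(p,1)`),
the generator of the stabiliser of `1/p`. [folklore] -/
def P1 (p n : ℕ) : Gamma0 (p * (p * n)) :=
  g0Of (1 - p * n) n (-(p * (p * n))) (1 + p * n) (by ring) ⟨-1, by push_cast; ring⟩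

/-- The parabolic `P_{2/p} = (1 − 2pn, 4n; −p²n, 1 + 2pn) ∈ Γ₀(p²n)` at the cusp `2/p` (`= diag(p,1)⁻¹ T Q₁ T⁻¹ diag(p,1)`),
the generator of the stabiliser of `2/p`. [folklore] -/
def P2 (p n : ℕ) : Gamma0 (p * (p * n)) :=
  g0Of (1 - 2 * (p * n)) (4 * n) (-(p * (p * n))) (1 + 2 * (p * n)) (by ring) ⟨-1, by push_cast; ring⟩

/-- `coshiftVal φ Q₁ = φ(P_{1/p})`. [folklore] -/
theorem coshiftVal_Q1 [NeZero p] : coshiftVal φ (Q1 p n) = φ (P1 p n) := by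
  rw [Q1, coshiftVal_g0Of φ (1 - p * n) n (-(p * n)) (1 + p * n) (by ring) _ (by ring) ⟨-1, by push_cast; ring⟩, P1]
  congr 1
  exact g0Of_congr rfl rfl (by ring) rfl _ _ _ _

/-- `coshiftVal φ (T Q₁ T⁻¹) = φ(P_{2/p})`. [folklore] -/
theorem coshiftVal_conj_Q1 [NeZero p] :
    coshiftVal φ (Tpow (p * n) 1 * Q1 p n * (Tpow (p * n) 1)⁻¹) = φ (P2 p n) := by
  rw [Tpow_inv, Q1, Tpow_one_mul_mul_Tpow_neg_one _ _ _ _ _ _ (by ring)]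
  have e : g0Of (M := p * n) (1 - (p : ℤ) * n + -(p * n)) (p * n + (1 + p * n) - (1 - p * n) - -(p * n)) (-(p * n))
        (1 + p * n - -(p * n)) (by ring) ⟨-1, by push_cast; ring⟩ =
      g0Of (1 - 2 * (p * n)) (p * (4 * n)) (-(p * n)) (1 + 2 * (p * n)) (by ring) ⟨-1, by push_cast; ring⟩ :=
    g0Of_congr (by ring) (by ring) rfl (by ring) _ _ _ _
  rw [e, coshiftVal_g0Of φ (1 - 2 * (p * n)) (4 * n) (-(p * n)) (1 + 2 * (p * n)) (by ring) _ (by ring)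
    ⟨-1, by push_cast; ring⟩, P2]
  congr 1
  exact g0Of_congr rfl rfl (by ring) rfl _ _ _ _

/-- **The Bézout decomposition `Γ₀(pn) = B·A⁺`**: for every `g` there is `b ∈ B = Γ₀(p²n)` with `b⁻¹ g ∈ A⁺`
(`b = δ·T^k` with `δ = (a, −v; p²n, u)` from `u·a + v·p²n = 1`). [folklore] -/
theorem exists_subB_inv_mul_mem_subA (g : Gamma0 (p * n)) : ∃ b ∈ subB p n, b⁻¹ * g ∈ subA p n := by
  obtain ⟨a, b, c, d, h, hc, rfl⟩ := exists_eq_g0Of g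
  obtain ⟨c₀, hc₀⟩ := hc
  -- `a` is prime to `p²n`
  have hcop : IsCoprime a ((p * (p * n) : ℕ) : ℤ) := by
    have h1 : IsCoprime a ((p * n : ℕ) : ℤ) := ⟨d, -(b * c₀), by rw [hc₀] at h; linear_combination h⟩
    have h2 : IsCoprime a (p : ℤ) :=
      IsCoprime.of_mul_right_left (show IsCoprime a ((p : ℤ) * n) by exact_mod_cast h1)
    have := IsCoprime.mul_right h2 h1
    exact_mod_cast (show IsCoprime a ((p : ℤ) * (p * n)) by exact_mod_cast this)
  obtain ⟨u, v, huv⟩ := hcop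
  set C : ℤ := ((p * (p * n) : ℕ) : ℤ) with hC
  have hCdvd : ((p * n : ℕ) : ℤ) ∣ C := ⟨p, by rw [hC]; push_cast; ring⟩
  have hδdet : a * u - (-v) * C = 1 := by linear_combination huv
  set k : ℤ := u * (b + v) with hk
  refine ⟨g0Of a (-v) C u hδdet hCdvd * Tpow (p * n) k, (subB p n).mul_mem ((mem_subB p n).mpr (dvd_refl _))
    (Tpow_mem_subB k), ?_⟩
  rw [g0Of_mul_Tpow a (-v) C u hδdet hCdvd k (by linear_combination hδdet), g0Of_inv,
    g0Of_mul _ _ _ _ _ _ _ _ _ _ _ _ (det_mul_entries (by linear_combination hδdet) h)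
      (dvd_add (Dvd.dvd.mul_right hCdvd.neg_right _) (Dvd.dvd.mul_left ⟨c₀, hc₀⟩ _)), mem_subA]
  have hpC : (p : ℤ) ∣ C := ⟨p * n, by rw [hC]; push_cast; ring⟩
  obtain ⟨C₁, hC₁⟩ := hpC
  have hpc : c = (p : ℤ) * (n * c₀) := by rw [hc₀]; push_cast; ring
  constructor
  · show (p : ℤ) ∣ (C * k + u) * b + -(a * k + -v) * d
    exact ⟨C₁ * u * (b + v) * b + v * C₁ * (b + v) * d - u * b * b * (n * c₀) - b * d * v * C₁, by
      rw [hk]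
      linear_combination (u * (b + v) * b + v * (b + v) * d - b * d * v) * hC₁ - (u * b * b) * hpc - (u * b) * h
        - (v * d) * huv⟩
  · show (p : ℤ) ∣ (C * k + u) * a + -(a * k + -v) * c - 1
    exact ⟨C₁ * k * a - v * C₁ - a * k * (n * c₀) + v * (n * c₀), by
      linear_combination huv + (v - a * k) * hpc + (k * a - v) * hC₁⟩

end Engine

/-! ### §3. The descent engine -/

section Descent

variable {K : Type*} [CommRing K] {p n : ℕ} [NeZero p]

/-- **THE PRIME-GENERIC DESCENT ENGINE.**  Let `p ≥ 1`, `φ : Γ₀(p²n) → K` additive and invariant under the `p`-shift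
(`φ(a, pb; c, d) = φ(a, b; pc, d)` for `p²n ∣ c`), and suppose `φ(P_{2/p}) = φ(P_{1/p})`.  Then `φ` is the restriction of an
additive `p`-shift-invariant `w : Γ₀(pn) → K`.  Proof: `φ∘coshift` is additive on `A₀ = {p ∣ b}`, agrees with `φ` on `A₀ ∩ B`
(`B = Γ₀(p²n)`) by shift invariance, and is invariant under `T`-conjugation on the NORMAL subgroup `A⁺ = Γ(p) ∩ Γ₀(pn)` by
`conj_invariant_of_generator` (`q = Q₁`, whose test `φ∘coshift(TQ₁T⁻¹) = φ∘coshift(Q₁)` is `φ(P_{2/p}) = φ(P_{1/p})`), hence under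
all of `B = (B ∩ A₀)·⟨T⟩`; `glueBA` along `Γ₀(pn) = B·A⁺` gives `w`, which equals `φ∘coshift` on all of `A₀` by additivity —
that is the `p`-shift invariance of `w`. [folklore] -/
theorem descent (φ : Gamma0 (p * (p * n)) → K) (hadd : IsAdd φ) (hinv : IsShiftInvariant (p : ℤ) φ)
    (hP : φ (P2 p n) = φ (P1 p n)) :
    ∃ w : Gamma0 (p * n) → K, IsAdd w ∧ IsShiftInvariant (p : ℤ) w ∧ RestrictsFrom φ w := by
  have hAn := subA_normal p n
  have hα0 := coshift_add φ hadd
  have hα : ∀ x ∈ subA p n, ∀ y ∈ subA p n, coshiftVal φ (x * y) = coshiftVal φ x + coshiftVal φ y :=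
    fun x hx y hy => hα0 x (subA_le_subA0 p n hx) y (subA_le_subA0 p n hy)
  have hβ := restr_add φ hadd
  have hC0 := coshift_eq_restr φ hinv
  have hC : ∀ x ∈ subA p n, x ∈ subB p n → coshiftVal φ x = restrVal φ x :=
    fun x hx hxB => hC0 x (subA_le_subA0 p n hx) hxB
  have ht : Tpow (p * n) 1 ∈ subB p n := Tpow_mem_subB 1
  have hκ : coshiftVal φ (Tpow (p * n) 1 * Q1 p n * (Tpow (p * n) 1)⁻¹) = coshiftVal φ (Q1 p n) := by
    rw [coshiftVal_conj_Q1, coshiftVal_Q1, hP]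
  have hinvT := conj_invariant_of_generator hAn hα hβ hC ht Q1_mem_subA exists_mul_Q1_zpow_mem_subB hκ
  -- invariance under all of `B`: `b = b₀ · T^k` with `b₀ ∈ A₀`, and `φ∘coshift` is additive on `A₀`
  have hinvB : ∀ b ∈ subB p n, ∀ a ∈ subA p n, coshiftVal φ (b * a * b⁻¹) = coshiftVal φ a := by
    intro b hb a ha
    set k : ℤ := ((b : SL(2, ℤ)) 1 1 : ℤ) * (b : SL(2, ℤ)) 0 1 with hk
    have hb0 : b * Tpow (p * n) 1 ^ (-k) ∈ subA0 p n := mul_Tpow_neg_mem_subA0 b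
    have hta : Tpow (p * n) 1 ^ k * a * (Tpow (p * n) 1 ^ k)⁻¹ ∈ subA p n := hAn.conj_mem a ha _
    have e : b * a * b⁻¹ = (b * Tpow (p * n) 1 ^ (-k)) * (Tpow (p * n) 1 ^ k * a * (Tpow (p * n) 1 ^ k)⁻¹) *
        (b * Tpow (p * n) 1 ^ (-k))⁻¹ := by group
    rw [e, hα0 _ ((subA0 p n).mul_mem hb0 (subA_le_subA0 p n hta)) _ ((subA0 p n).inv_mem hb0),
      hα0 _ hb0 _ (subA_le_subA0 p n hta), addOn_map_inv hα0 hb0, conj_zpow_invariant hAn hinvT k a ha]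
    abel
  obtain ⟨W, hW, hWA, hWB⟩ := glueBA hAn hα hβ hC hinvB exists_subB_inv_mul_mem_subA
  -- `W = φ∘coshift` on all of `A₀`
  have hWA0 : ∀ x ∈ subA0 p n, W x = coshiftVal φ x := by
    intro x hx
    obtain ⟨b, hb, hbx⟩ := exists_subB_inv_mul_mem_subA (p := p) (n := n) x
    have hb0 : b ∈ subA0 p n := by
      have e : b = x * (b⁻¹ * x)⁻¹ := by group
      rw [e]; exact (subA0 p n).mul_mem hx ((subA0 p n).inv_mem (subA_le_subA0 p n hbx))
    have e : x = b * (b⁻¹ * x) := by group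
    rw [e, hW, hWB b hb, hWA _ hbx, ← hC0 b hb0 hb, ← hα0 b hb0 _ (subA_le_subA0 p n hbx)]
  refine ⟨W, hW, ?_, ?_⟩
  · intro a b c d h hc
    rw [hWA0 _ (g0Of_mem_subA0 a b c d (by linear_combination h) hc),
      coshiftVal_g0Of φ a b c d (by linear_combination h) hc h (dvd_p_mul hc),
      hWB _ (g0Of_mem_subB a b (p * c) d h _ (dvd_p_mul hc)), restrVal_g0Of φ a b (p * c) d h _ (dvd_p_mul hc)]
  · intro a b c d h hcN hcM
    rw [hWB _ (g0Of_mem_subB a b c d h hcM hcN), restrVal_g0Of φ a b c d h hcM hcN]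

end Descent

end PrimeShift

end Summit.BirchSwinnertonDyer.BirchSwinnertonDyer.Theorems.ManinLocalTwoThree
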